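import Mathlib
import Summits.NavierStokesRegularity.NavierStokesRegularity.Theorems.TypeIQuarterGateScarEnvelopeTypeIZoomDictionaryDefs
import Summits.NavierStokesRegularity.NavierStokesRegularity.Theorems.TypeIQuarterGateScarEnvelopeTypeIZoomDictionaryAbstract
import Summits.NavierStokesRegularity.NavierStokesRegularity.Theorems.TypeIQuarterGateScarEnvelopeTypeIZoomDictionaryLemmas
import Summits.NavierStokesRegularity.NavierStokesRegularity.Theorems.TypeIQuarterGateScarEnvelopeTypeIZoomDictionaryUnitInputs

/-!
# Part D: the dictionary in the tree's currency and the discharge of F3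

Part D of the plate: `dictionaryU`, `octaveBudget_iff_noSatelliteU`, the `u`-side discharge for classical solutions, and `LocalESSU` as a THEOREM (ESS Thm 1.4 in the tree, `ess_local_holder_holds`).

PROVENANCE: declaration texts VERBATIM from the HOME plates of the instrument seat nsreg-p3 (g24/g25, cell
`pub/ns-regularity-ideate`): `round-31/Tangent31prep.lean` v5 (sha16 `e5b8668e3a090216`; = ROUND-30 plate v10 + Part K) and,
for Part L, `round-32/Tangent32prep.lean` v6 (sha16 `6123f27718636121`);
the author cannot write under `Theorems/` (`perm.theorems-prover-only`); landed by the
LEAD-lineage prover ns-sz-p1 g5 on director-ns DIRECTOR-NS #218 (2), split into ≤ 400-line modules (the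
plate's `def`s gathered in `TypeIQuarterGateScarEnvelopeTypeIZoomDictionaryDefs`), namespace
`Summit.NavierStokesRegularity.NavierStokesRegularity.Cruxes.ScarEnvelopeTypeI.ZoomDictionary` (the plate's `NsregP3.R30P`), `E3` spelled out, one-line docstrings
added where the plate had none.  `--supports stmt-NavierStokesRegularity-23843 --as helper`.

HONEST FRAMING: dictionary / census TOOLING for the crux `TypeIQuarterGate.ScarEnvelopeTypeI` (item 23843):
equivalences and normal forms, kernel-checked; NO open statement is proved — 23843, its parent
`QuarterLawTypeI` (23726), the route and Navier–Stokes regularity are OPEN; hard core evaded: none.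
-/

-- the summit-side namespace repeats a component by design (single-conjunct summit, D-0017)
set_option linter.dupNamespace false

open MeasureTheory Set Metric Filter Topology
open scoped ENNReal

namespace Summit.NavierStokesRegularity.NavierStokesRegularity.Cruxes.ScarEnvelopeTypeI.ZoomDictionary

variable {u : ℝ → (EuclideanSpace ℝ (Fin 3)) → (EuclideanSpace ℝ (Fin 3))} {a : (EuclideanSpace ℝ (Fin 3))} {ν T : ℝ}

section UnitNormalisation

open Literature.Analysis.FluidPDE
variable {u : ℝ → (EuclideanSpace ℝ (Fin 3)) → (EuclideanSpace ℝ (Fin 3))} {p : ℝ → (EuclideanSpace ℝ (Fin 3)) → ℝ} {a : (EuclideanSpace ℝ (Fin 3))} {T : ℝ}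

/-! ### The dictionary in the tree's currency, and the `u`-side discharge for classical solutions -/

/-- **The dictionary (ν = 1, tree currency).** I1 is the tree theorem `SuitableCompactness_holds`;
the remaining fact hypotheses are `PersistenceU` and `LocalESSU`; the `u`-side hypotheses are
continuity on the strip, the Type-I rate, and that small zooms lie in A–B's class on the unit
ball with uniform `L³ × L^{3/2}` bounds (for classical Leray–Hopf solutions: `zoomsInBall_of_classical`,
`zoomsBddU_of_vertexBounds`).  Conclusion: the slice-dimension budget at `a` holds iff every
tangent flow `ū` (along any positive null scale sequence, recorded as in `SuitableCompactness`)
is essentially bounded near each final-time point `(0, c₀⁻¹ y)`, `1 ≤ |y| ≤ e`. -/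
theorem dictionaryU (hT : 0 < T) (hcont : ContinuousOn (Function.uncurry u) (Ioo 0 T ×ˢ univ))
    (hTI : IsTypeIBlowup u T) (hZ : ZoomsInBall u p a T) (hB : ZoomsBddU u p a T)
    (F2 : PersistenceU) (F3 : LocalESSU) :
    BudgetAt 1 T u a ↔ ∀ L ū, TangentU u p a T L ū → ∀ y ∈ unitAnn, RegU ū y := by
  have h := budgetAt_iff_regular' (u := u) (a := a) (T := T) (ν := 1) one_pos i0_tangentOf
    (i1_of_suitableCompactness hZ hB) (i2_of_persistenceU hT hcont F2 hZ hB)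
    (i3_of_localESSU hT hcont F3) hTI
  refine h.trans ⟨fun H L ū hL => ?_, fun H ℓ ū hℓ => H _ ū hℓ⟩
  have e : (fun k => c₀ * (c₀⁻¹ * L k)) = L := funext fun k => mul_inv_cancel_left₀ c₀_pos.ne' _
  have hL' : TangentOf u p a T (fun k => c₀⁻¹ * L k) ū := by
    show TangentU u p a T (fun k => c₀ * (c₀⁻¹ * L k)) ū
    rw [e]; exact hL
  exact H _ ū hL'

/-- The same for the tree's `OctaveBudget` at `ν = 1` (all scars at once). -/
theorem octaveBudget_iff_noSatelliteU (hT : 0 < T)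
    (hcont : ContinuousOn (Function.uncurry u) (Ioo 0 T ×ˢ univ)) (hTI : IsTypeIBlowup u T)
    (hZ : ∀ a, ZoomsInBall u p a T) (hB : ∀ a, ZoomsBddU u p a T)
    (F2 : PersistenceU) (F3 : LocalESSU) :
    Summit.NavierStokesRegularity.NavierStokesRegularity.Cruxes.ScarEnvelopeTypeI.SliceBudget.OctaveBudget
        1 T u ↔
      ∀ a, Summit.NavierStokesRegularity.NavierStokesRegularity.Cruxes.ScarEnvelopeTypeI.SliceBudget.SingularPt
          T u a → ∀ L ū, TangentU u p a T L ū → ∀ y ∈ unitAnn, RegU ū y :=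
  octaveBudget_iff_budgetAt.trans (forall_congr' fun a => imp_congr_right fun _ =>
    dictionaryU hT hcont hTI (hZ a) (hB a) F2 F3)

/-- **`ZoomsInBall` for a classical Leray–Hopf solution on `[0,T)` (ν = 1), gauged pressure**
(tree: `SereginSverak2002.isSuitableWeakSolutionInBall_vertex` + `IsSuitableWeakSolutionInBall.zoom`). -/
theorem zoomsInBall_of_classical (hT : 0 < T) (hsol : IsClassicalNSSolutionOn (Ico 0 T) 1 0 u p)
    (hLH : IsLerayHopfOn T 1 0 (u 0) u) (a : (EuclideanSpace ℝ (Fin 3))) :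
    ZoomsInBall u (fun t x => p t x - (p t 0 - normalisedPressure (u t) 0)) a T := by
  refine ⟨Real.sqrt T, Real.sqrt_pos.2 hT, fun L hL hLT => ?_⟩
  have hLT' : L ^ 2 ≤ T := by
    calc L ^ 2 ≤ Real.sqrt T ^ 2 := pow_le_pow_left₀ hL.le hLT 2
      _ = T := Real.sq_sqrt hT.le
  have h := (SereginSverak2002.isSuitableWeakSolutionInBall_vertex hT hsol hLH a hLT').zoom hL
  rw [zoom_eq_smul_stPull, zoomP_eq_smul_stPull]
  exact h

/-- **`ZoomsBddU` from vertex bounds** `C(r; (T,a)) ≤ M`, `D(r; (T,a)) ≤ D` for `0 < r ≤ r₁`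
(tree: `lintegral_cube_zoom`, `lintegral_pressure_zoom`). -/
theorem zoomsBddU_of_vertexBounds {q : ℝ → (EuclideanSpace ℝ (Fin 3)) → ℝ} {M D : ℝ≥0∞} (hMt : M < ⊤) (hDt : D < ⊤)
    {r₁ : ℝ} (hr₁ : 0 < r₁) (hM : ∀ r, 0 < r → r ≤ r₁ → cknC r ((T, a) : ℝ × (EuclideanSpace ℝ (Fin 3))) u ≤ M)
    (hD : ∀ r, 0 < r → r ≤ r₁ → cknD r ((T, a) : ℝ × (EuclideanSpace ℝ (Fin 3))) q ≤ D) : ZoomsBddU u q a T := by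
  refine ⟨M ^ (1 / 3 : ℝ) + D ^ (2 / 3 : ℝ), ENNReal.add_lt_top.2
    ⟨ENNReal.rpow_lt_top_of_nonneg (by norm_num) hMt.ne,
      ENNReal.rpow_lt_top_of_nonneg (by norm_num) hDt.ne⟩, r₁, hr₁, fun L hL hLr => ?_⟩
  rw [zoom_eq_smul_stPull, zoomP_eq_smul_stPull]
  refine add_le_add ?_ ?_
  · rw [eLpNorm_eq_lintegral_rpow_enorm_toReal (by norm_num) (by norm_num)]
    have e : (3 : ℝ≥0∞).toReal = 3 := by norm_num
    rw [e]
    refine ENNReal.rpow_le_rpow ?_ (by norm_num)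
    have h1 : ∫⁻ w in parabolicCylinder 1 (0 : ℝ × (EuclideanSpace ℝ (Fin 3))),
        ‖(L • stPull (L ^ 2) L T a u) w.1 w.2‖ₑ ^ (3 : ℕ) ≤ M := by
      have := lintegral_cube_zoom hL ((T, a) : ℝ × (EuclideanSpace ℝ (Fin 3))) u
      simp only [] at this
      rw [this]
      exact hM L hL hLr
    refine le_trans (le_of_eq ?_) h1
    refine lintegral_congr fun w => ?_
    rw [show (3 : ℝ) = ((3 : ℕ) : ℝ) by norm_num, ENNReal.rpow_natCast]
    rfl
  · rw [eLpNorm_eq_lintegral_rpow_enorm_toReal (by norm_num)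
      (ENNReal.div_ne_top (by norm_num) (by norm_num))]
    have e : (3 / 2 : ℝ≥0∞).toReal = 3 / 2 := by
      rw [ENNReal.toReal_div]; norm_num
    rw [e, show (1 / (3 / 2) : ℝ) = 2 / 3 by norm_num]
    refine ENNReal.rpow_le_rpow ?_ (by norm_num)
    have h1 : ∫⁻ w in parabolicCylinder 1 (0 : ℝ × (EuclideanSpace ℝ (Fin 3))),
        ‖(L ^ 2 • stPull (L ^ 2) L T a q) w.1 w.2‖ₑ ^ (3 / 2 : ℝ) ≤ D := by
      have := lintegral_pressure_zoom hL ((T, a) : ℝ × (EuclideanSpace ℝ (Fin 3))) q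
      simp only [] at this
      rw [this]
      exact hD L hL hLr
    exact h1

/-- **The dictionary for a classical Leray–Hopf Type-I solution on `[0,T)` (ν = 1)**, modulo the
two remaining fact-shaped Props and the vertex bounds `C, D ≤ K` at `(T, a)` for the gauged pair
(for Type I these follow from `scaledEnergies_bounded_of_typeIRate`, cf. the tree's
`SelfMixingDichotomyCoherentScaleExclusionTypeIRateCeiling`). -/
theorem dictionaryU_of_classical (hT : 0 < T) (hsol : IsClassicalNSSolutionOn (Ico 0 T) 1 0 u p)
    (hLH : IsLerayHopfOn T 1 0 (u 0) u) (hTI : IsTypeIBlowup u T)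
    {M D : ℝ≥0∞} (hMt : M < ⊤) (hDt : D < ⊤) {r₁ : ℝ} (hr₁ : 0 < r₁)
    (hM : ∀ r, 0 < r → r ≤ r₁ → cknC r ((T, a) : ℝ × (EuclideanSpace ℝ (Fin 3))) u ≤ M)
    (hD : ∀ r, 0 < r → r ≤ r₁ →
      cknD r ((T, a) : ℝ × (EuclideanSpace ℝ (Fin 3))) (fun t x => p t x - (p t 0 - normalisedPressure (u t) 0)) ≤ D)
    (F2 : PersistenceU) (F3 : LocalESSU) :
    BudgetAt 1 T u a ↔
      ∀ L ū, TangentU u (fun t x => p t x - (p t 0 - normalisedPressure (u t) 0)) a T L ū →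
        ∀ y ∈ unitAnn, RegU ū y :=
  dictionaryU hT (continuousOn_of_classical hsol) hTI (zoomsInBall_of_classical hT hsol hLH a)
    (zoomsBddU_of_vertexBounds hMt hDt hr₁ hM hD) F2 F3

/-! ### `LocalESSU` is a theorem: ESS Thm 1.4 in the tree (`ess_local_holder_holds`) -/

/-- A–B's class on `Q_ρ(0, y)` plus an `L^{3,∞}` bound is ESS's class (1.15)–(1.16) there. -/
theorem isL3inftyLocalPair_of_inBall {v : ℝ → (EuclideanSpace ℝ (Fin 3)) → (EuclideanSpace ℝ (Fin 3))} {q : ℝ → (EuclideanSpace ℝ (Fin 3)) → ℝ} {y : (EuclideanSpace ℝ (Fin 3))} {ρ : ℝ}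
    (h : IsSuitableWeakSolutionInBall ρ ((0 : ℝ), y) v q)
    (hL3 : ∃ C : ℝ≥0∞, C < ⊤ ∧ ∀ᵐ s ∂(volume.restrict (Ioo (-(ρ ^ 2)) 0)),
      ∫⁻ x in ball y ρ, ‖v s x‖ₑ ^ (3 : ℝ) ≤ C) :
    IsL3inftyLocalPair 1 ρ ((0 : ℝ), y) v q := by
  obtain ⟨hsw, hE, hG, hp⟩ := h
  obtain ⟨C, hC, hL⟩ := hL3
  refine ⟨?_, ?_, ?_, ?_, ?_⟩
  · rw [viscousCylinderOpens_one]; exact hsw.distributional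
  · simpa only [div_one] using hE
  · rw [viscousCylinderOpens_one, viscousCylinder_one]; exact hG
  · rw [viscousCylinder_one]
    have e : (3 / 2 : ℝ≥0∞).toReal = 3 / 2 := by rw [ENNReal.toReal_div]; norm_num
    have h1 := lintegral_rpow_enorm_lt_top_of_eLpNorm_lt_top (by norm_num)
      (ENNReal.div_ne_top (by norm_num) (by norm_num)) hp.eLpNorm_lt_top
    rw [e] at h1
    exact h1
  · refine ⟨C.toNNReal, ?_⟩
    rw [ENNReal.coe_toNNReal hC.ne]
    have e : Ioo (((0 : ℝ), y).1 - ρ ^ 2 / 1) ((0 : ℝ), y).1 = Ioo (-(ρ ^ 2)) 0 := by simp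
    rw [e]
    filter_upwards [hL] with s hs
    simpa only [ENNReal.rpow_ofNat] using hs

/-- **`LocalESSU` holds** — by the tree's ESS Thm 1.4 (`ess_local_holder_holds`) through
`IsL3inftyLocalPair.exists_ae_bound` (rescaling to the unit cylinder, Hölder representative,
transport back). -/
theorem localESSU_holds : LocalESSU := by
  intro v q y ρ hρ hIB hL3
  obtain ⟨M, hM⟩ :=
    (isL3inftyLocalPair_of_inBall hIB hL3).exists_ae_bound ess_local_holder_holds one_pos hρ
  refine ⟨M, ?_⟩
  rw [viscousCylinder_one] at hM
  exact hM

end UnitNormalisation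

end Summit.NavierStokesRegularity.NavierStokesRegularity.Cruxes.ScarEnvelopeTypeI.ZoomDictionary
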